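import Summits.Ventures.PercRepro.S1CoreCapSevenTwoNon

/-!
# PercRepro — TOWARDS `Q*(8)`: TWO BIG LINES IN NO PLANE (p1, gen 27)

The `ν = 8` reading of `S1CoreCapSevenTwoNon`: two lines `L₁, L₂` of `≥ 4` points in no common duplicate-free
list of `lineRank ≤ 3`. They are disjoint (`Seven.disjoint_of_noncoplanar`) and at most one chord passes
through each point off them (`Seven.chord_unique_of_noncoplanar`: two chords through a hub put both in the
plane `[L₂, L₁, c′, c]`), so the other lines form a family over `L₂ ∪ L₁` with at most two points on it and at
most one chord per hub, with budget `12 − |L₁| − |L₂| − fat L₁ − fat L₂` on free lines and new fat points; the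
fat counting lemma with chords (`Seven.two_mul_sum_cap_chord_le`) bounds its cap by
`b (b + 1) / 2 + (fat L₁ + fat L₂) b`: cap `≤ 8 + 10 = 18` for two simple 4-point lines (`b = 4`), and less for
the heavier shapes — `sum_cap_le_eighteen_of_two_big_noncoplanar`. `proofs/P1-S4-CAPBRIDGE.md` §19.
Axioms: standard.
-/

namespace PercRepro

namespace S1

namespace FourCap

namespace Eight

open Seven

variable {β : Type} [DecidableEq β]

section TwoBigNoncoplanar

variable {w : β → ℕ} {ls : Finset (Finset β)}
  (h1 : ∀ L ∈ ls, ∀ v ∈ L, w v = 1 ∨ w v = 2)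
  (h2 : ∀ L ∈ ls, 3 ≤ L.card ∧ wsum w L ≤ 5)
  (h3 : ∀ L ∈ ls, ∀ L' ∈ ls, L ≠ L' → (L ∩ L').card ≤ 1)
  (h4 : ∀ l : List (Finset β), l.Nodup → (∀ L ∈ l, L ∈ ls) → wsum w (unionL l) ≤ 8 + lineRank l)
  {L₁ L₂ : Finset β} (hL₁ : L₁ ∈ ls) (hL₂ : L₂ ∈ ls) (h12 : L₂ ≠ L₁)
  (c1 : 4 ≤ L₁.card) (c2 : 4 ≤ L₂.card)
  (hrest : ∀ L ∈ ls, L ≠ L₁ → L ≠ L₂ → L.card = 3)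
  (hnc : ¬ ∃ l : List (Finset β), l.Nodup ∧ (∀ L ∈ l, L ∈ ls) ∧ lineRank l ≤ 3 ∧ L₁ ∈ l ∧ L₂ ∈ l)

include h1 h2 h3 h4 hL₁ hL₂ h12 c1 c2 hrest hnc in
/-- **Two big lines in no plane at nullity `8`: cap sum `≤ 18`**. -/
theorem sum_cap_le_eighteen_of_two_big_noncoplanar : ∑ L ∈ ls, capPaper L.card (fat w L) ≤ 18 := by
  have h2' := two_le_card_of_spec₇ h2
  have hdisj := disjoint_of_noncoplanar h3 hL₁ hL₂ h12 c1 c2 hnc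
  set T := (ls.erase L₁).erase L₂ with hT
  have hTmem : ∀ L ∈ T, L ∈ ls ∧ L ≠ L₁ ∧ L ≠ L₂ := fun L hL => by
    have h2'' := Finset.mem_erase.1 hL
    have h1' := Finset.mem_erase.1 h2''.2
    exact ⟨h1'.2, h1'.1, h2''.1⟩
  have hT3 : ∀ L ∈ T, L.card = 3 := fun L hL => hrest L (hTmem L hL).1 (hTmem L hL).2.1 (hTmem L hL).2.2
  -- the budget over `L₂ ∪ L₁`
  have hk : ∀ t : List (Finset β), t.Nodup → (∀ L ∈ t, L ∈ T) →
      freeCountR (L₂ ∪ L₁) t + fat w (unionLR (L₂ ∪ L₁) t \ (L₂ ∪ L₁)) + L₁.card + L₂.card + fat w L₁ +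
        fat w L₂ ≤ 12 := by
    intro t hndt hlt
    have hb := budget_of_prefix h1 h2' h4 [L₂, L₁] t (by
      rw [List.nodup_append']
      refine ⟨hndt, by simp [h12], fun L hLt hLl => ?_⟩
      simp only [List.mem_cons, List.not_mem_nil, or_false] at hLl
      rcases hLl with rfl | rfl
      · exact (hTmem L (hlt L hLt)).2.2 rfl
      · exact (hTmem L (hlt L hLt)).2.1 rfl)
      (fun L hL => by
        rcases List.mem_append.1 hL with hL | hL
        · exact (hTmem L (hlt L hL)).1
        · simp only [List.mem_cons, List.not_mem_nil, or_false] at hL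
          rcases hL with rfl | rfl
          · exact hL₂
          · exact hL₁)
      (fun L hL => hT3 L (hlt L hL))
    simp only [unionL, costSum, Finset.union_empty, Nat.zero_add, lineCost_empty] at hb
    rw [lineCost_of_inter_le_two (by omega)] at hb
    have hsplit := fat_sdiff_add_fat_of_subset w (subset_unionLR (L₂ ∪ L₁) t)
    have hdisj' : Disjoint L₂ L₁ := Finset.disjoint_iff_inter_eq_empty.2 (Finset.card_eq_zero.1 hdisj)
    have hf12 : fat w (L₂ ∪ L₁) = fat w L₂ + fat w L₁ := by
      unfold fat
      rw [Finset.filter_union, Finset.card_union_of_disjoint (Finset.disjoint_filter_filter hdisj')]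
    have hsd : L₂ \ L₁ = L₂ := Finset.sdiff_eq_self_of_disjoint hdisj'
    rw [hsd] at hb
    omega
  -- the family with chords
  have hthin := two_mul_sum_cap_chord_le w (L₂ ∪ L₁) T (b := 12 - L₁.card - L₂.card - fat w L₁ - fat w L₂)
    (fun L hL => ⟨hT3 L hL, by
      have := card_inter_union_le L L₂ L₁
      have := h3 L (hTmem L hL).1 L₂ hL₂ (hTmem L hL).2.2
      have := h3 L (hTmem L hL).1 L₁ hL₁ (hTmem L hL).2.1
      omega⟩)
    (fun L hL L' hL' hne => h3 L (hTmem L hL).1 L' (hTmem L' hL').1 hne)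
    (fun v hv L hL L' hL' hvL hvL' hLP hL'P => by
      rw [Finset.union_comm] at hv hLP hL'P
      exact chord_unique_of_noncoplanar h3 hL₁ hL₂ h12 c1 c2 hrest hnc hv (hTmem L hL).1 (hTmem L' hL').1
        (hTmem L hL).2.1 (hTmem L hL).2.2 (hTmem L' hL').2.1 (hTmem L' hL').2.2 hvL hvL' hLP hL'P)
    (fun L hL => h1 L (hTmem L hL).1) (fun L hL => (h2 L (hTmem L hL).1).2)
    (fun t hndt hlt => by have := hk t hndt hlt; omega)
  -- the sum
  have hsum := Finset.add_sum_erase ls (fun L => capPaper L.card (fat w L)) hL₁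
  have hsum' := Finset.add_sum_erase (ls.erase L₁) (fun L => capPaper L.card (fat w L))
    (Finset.mem_erase.2 ⟨h12, hL₂⟩)
  rw [← hT] at hsum'
  rw [← hsum, ← hsum']
  have hcap1 := capPaper_big_eq h1 h2 hL₁ c1
  have hcap2 := capPaper_big_eq h1 h2 hL₂ c2
  rw [hcap1, hcap2]
  have hw1 := (h2 L₁ hL₁).2
  have hw2 := (h2 L₂ hL₂).2
  have hwa := wsum_eq_card_add_fat w L₁ (h1 L₁ hL₁)
  have hwb := wsum_eq_card_add_fat w L₂ (h1 L₂ hL₂)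
  have hdisj' : Disjoint L₂ L₁ := Finset.disjoint_iff_inter_eq_empty.2 (Finset.card_eq_zero.1 hdisj)
  have hf12 : fat w (L₂ ∪ L₁) = fat w L₂ + fat w L₁ := by
    unfold fat
    rw [Finset.filter_union, Finset.card_union_of_disjoint (Finset.disjoint_filter_filter hdisj')]
  rw [hf12] at hthin
  have hs1 : (L₁.card = 4 ∧ fat w L₁ = 0) ∨ (L₁.card = 5 ∧ fat w L₁ = 0) ∨ (L₁.card = 4 ∧ fat w L₁ = 1) := by
    omega
  have hs2 : (L₂.card = 4 ∧ fat w L₂ = 0) ∨ (L₂.card = 5 ∧ fat w L₂ = 0) ∨ (L₂.card = 4 ∧ fat w L₂ = 1) := by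
    omega
  rcases hs1 with ⟨hk1, ha⟩ | ⟨hk1, ha⟩ | ⟨hk1, ha⟩ <;> rcases hs2 with ⟨hk2, hb⟩ | ⟨hk2, hb⟩ | ⟨hk2, hb⟩ <;>
    rw [hk1, hk2, ha, hb] at hthin ⊢ <;> omega

end TwoBigNoncoplanar

end Eight

end FourCap

end S1

end PercRepro
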